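import Summits.QuantumAdvantage.AdviceFreeQNC0.GraphKernelParity
import Mathlib.LinearAlgebra.Basis.VectorSpace
import HarnessLib

/-!
# Cell qa-qnc0 (rung F-Q1, route RingFrame, crux α `RingToElim`): the no-go N3 "few kernel types ⇒ easy"
# for GRAPHS (symmetric, loop-free adjacency) — the repaired `FewTypesEasy` of planner qa-qnc0-p2 ROUND-7

Planner qa-qnc0-p2 gen 7 (`HOME/qa-qnc0-p2/ROUND-7.md` §4 door D-G, `line/Sketch7.lean` N3).  The sketch's
`FewTypesEasy` is false for adjacency matrices with loops (`not_fewTypesEasy`, `GraphHLF.lean`); here the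
intended statement is PROVED for a symmetric loop-free `adj` (a graph `G`), on top of the additivity of
the sign bit on the kernel (`GraphKernelParity.lean`):

* `GraphN3.ellF_mem_lowDeg_two` — `x ↦ ℓ_x(v)` has `𝔽₂`-degree `≤ 2` (`⌊|x∧v|/2⌋ ≡ C(|x∧v|,2)
  = Σ` of the degree-`2` monomials on `supp v`, `choose_two_mod_two`, `wtAnd_div_two_cast`);
* `GraphN3.exists_dualVec` — an independent list `L` over `𝔽₂` has dual vectors `w_j` (`⟨L_i, w_j⟩ = δ_ij`;
  `Module.Basis.span` + `LinearMap.exists_extend`);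
* **`GraphN3.fewTypesEasy_graph`** / `fewTypesEasy_of_graph` — if every kernel `Ker(A_G + diag x)` is
  spanned by the members of ONE fixed independent list `L` lying in it, the degree-`2` map
  `s(x) = Σ_j ℓ_x(L_j)·w_j` solves EVERY instance of `RelG` (span induction: kernel membership and
  `⟨y, s(x)⟩ = ℓ_x(y)` are both additive in `y`).

WHAT THIS IS NOT: a no-go for one approach to "another graph" (door D-G, closed by the planner); nothing
on α; separation NOT moved.
-/

noncomputable section

namespace Summit.QuantumAdvantage.AdviceFreeQNC0

open Finset
open Literature.Computability.QuantumComplexity Literature.Computability.QuantumComplexity.RingHLF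
open Literature.Computability.MetaComplexity Literature.Computability.MetaComplexity.Smolensky

namespace GraphN3

variable {m : ℕ} {adj : Fin m → Fin m → Bool} (x : Fin m → Bool)

/-! ### The sign bit has degree `2` in the instance -/

/-- The sign bit `x ↦ ℓ_x(v)` as an `𝔽₂`-valued function of the instance. -/
def ellF (A : Fin m → Fin m → Bool) (v : Fin m → Bool) : CubeFn (ZMod 2) m :=
  fun y => ((signBitG A y v : ℕ) : ZMod 2)

/-- `C(n,2) ≡ ⌊n/2⌋ (mod 2)` (Pascal twice: `C(n+2,2) = C(n,2) + 2n + 1`). -/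
theorem choose_two_mod_two (n : ℕ) : n.choose 2 % 2 = (n / 2) % 2 := by
  -- Pascal `C(k+1,2) = k + C(k,2)` (also in the tree as `Literature.AlgebraicGeometry.Motives.choose_two_succ`)
  have pascal : ∀ k : ℕ, (k + 1).choose 2 = k + k.choose 2 := fun k => by
    rw [show 2 = 1 + 1 from rfl, Nat.choose_succ_succ', Nat.choose_one_right]
  induction n using Nat.twoStepInduction with
  | zero => rfl
  | one => rfl
  | more n ih _ =>
    have h1 := pascal n
    have h2 : (n + 2).choose 2 = (n + 1) + (n + 1).choose 2 := pascal (n + 1)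
    have e1 : (n + 2) / 2 = n / 2 + 1 := by omega
    rw [e1, h2, h1]
    generalize n / 2 = q at ih ⊢
    generalize n.choose 2 = X at ih ⊢
    omega

/-- `⌊|x ∧ v|/2⌋ ≡ Σ_{T ⊆ supp v, |T| = 2} x^T (mod 2)`. -/
theorem wtAnd_div_two_cast (v : Fin m → Bool) (x : Fin m → Bool) :
    (((wtAnd x v / 2 : ℕ)) : ZMod 2) =
      ∑ T ∈ (univ.filter fun b : Fin m => v b = true).powersetCard 2, mono (ZMod 2) T x := by
  classical
  set Sv := (univ.filter fun b : Fin m => v b = true) with hSv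
  set Sxv := (univ.filter fun b : Fin m => x b = true ∧ v b = true) with hSxv
  have hwt : wtAnd x v = Sxv.card := rfl
  -- `⌊n/2⌋ ≡ C(n,2)` and `C(#Sxv, 2) = #(Sxv.powersetCard 2)`
  have h1 : (((wtAnd x v / 2 : ℕ)) : ZMod 2) = (((Sxv.powersetCard 2).card : ℕ) : ZMod 2) := by
    refine (ZMod.natCast_eq_natCast_iff' _ _ 2).2 ?_
    rw [Finset.card_powersetCard, hwt, choose_two_mod_two]
  -- the `2`-subsets of `Sxv` are the `2`-subsets of `Sv` inside `supp x`
  have h2 : Sxv.powersetCard 2 = (Sv.powersetCard 2).filter fun T => ∀ i ∈ T, x i = true := by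
    ext T
    simp only [mem_powersetCard, mem_filter, hSv, hSxv, subset_iff, mem_univ, true_and]
    constructor
    · rintro ⟨hT, hc⟩; exact ⟨⟨fun i hi => (hT hi).2, hc⟩, fun i hi => (hT hi).1⟩
    · rintro ⟨⟨hT, hc⟩, hx⟩; exact ⟨fun i hi => ⟨hx i hi, hT hi⟩, hc⟩
  rw [h1, h2, Finset.card_filter, Nat.cast_sum]
  refine Finset.sum_congr rfl fun T _ => ?_
  rw [mono_apply]
  by_cases h : ∀ i ∈ T, x i = true
  · rw [if_pos h, if_pos h, Nat.cast_one]
  · rw [if_neg h, if_neg h, Nat.cast_zero]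

/-- **`x ↦ ℓ_x(v)` has `𝔽₂`-degree `≤ 2`.** -/
theorem ellF_mem_lowDeg_two (v : Fin m → Bool) : ellF adj v ∈ lowDeg (ZMod 2) m 2 := by
  classical
  have heq : ellF adj v = ((edgesInG adj v : ℕ) : ZMod 2) • (1 : CubeFn (ZMod 2) m) +
      ∑ T ∈ (univ.filter fun b : Fin m => v b = true).powersetCard 2, mono (ZMod 2) T := by
    funext x
    simp only [ellF, signBitG, Pi.add_apply, Pi.smul_apply, Pi.one_apply, smul_eq_mul, mul_one,
      Finset.sum_apply]
    rw [ZMod.natCast_mod, Nat.cast_add, wtAnd_div_two_cast]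
  rw [heq]
  refine Submodule.add_mem _ (Submodule.smul_mem _ _ ?_) (Submodule.sum_mem _ fun T hT => ?_)
  · rw [← mono_empty]; exact mono_mem_lowDeg (by simp)
  · exact mono_mem_lowDeg (by rw [(mem_powersetCard.1 hT).2])

/-! ### Dual vectors of an independent list -/

/-- An independent list over `𝔽₂` has dual vectors: `Σ_b L_i(b)·w_j(b) = δ_ij`. -/
theorem exists_dualVec {k : ℕ} (L : Fin k → (Fin m → Bool))
    (hli : LinearIndependent (ZMod 2) (fun j => toZ (L j))) :
    ∃ w : Fin k → (Fin m → ZMod 2), ∀ i j, ∑ b : Fin m, toZ (L i) b * w j b = if i = j then 1 else 0 := by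
  classical
  have hext : ∀ j : Fin k, ∃ g : (Fin m → ZMod 2) →ₗ[ZMod 2] ZMod 2,
      g.comp (Submodule.span (ZMod 2) (Set.range fun j => toZ (L j))).subtype = (Module.Basis.span hli).coord j :=
    fun j => LinearMap.exists_extend _
  choose g hg using hext
  refine ⟨fun j b => g j (Pi.single b 1), fun i j => ?_⟩
  have hsum : ∑ b : Fin m, toZ (L i) b * g j (Pi.single b 1) = g j (toZ (L i)) := by
    conv_rhs => rw [pi_eq_sum_univ' (toZ (L i))]
    rw [map_sum]
    refine Finset.sum_congr rfl fun b _ => ?_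
    rw [map_smul, smul_eq_mul]
  rw [hsum]
  have hmem : toZ (L i) ∈ Submodule.span (ZMod 2) (Set.range fun j => toZ (L j)) :=
    Submodule.subset_span (Set.mem_range_self i)
  have h1 : g j (toZ (L i)) =
      ((g j).comp (Submodule.span (ZMod 2) (Set.range fun j => toZ (L j))).subtype) ⟨toZ (L i), hmem⟩ := rfl
  rw [h1, hg j]
  have h2 : (⟨toZ (L i), hmem⟩ : Submodule.span (ZMod 2) (Set.range fun j => toZ (L j))) =
      Module.Basis.span hli i := by
    rw [Module.Basis.span_apply]
  rw [h2, Module.Basis.coord_apply, Module.Basis.repr_self, Finsupp.single_apply]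

/-! ### The repaired N3 -/

/-- `𝔽₂`-vector to `0/1`-vector. -/
def ofZ (y : Fin m → ZMod 2) : Fin m → Bool := fun b => decide (y b = 1)

/-- `ofZ ∘ toZ = id`. -/
theorem ofZ_toZ (v : Fin m → Bool) : ofZ (toZ v) = v := by
  funext b; unfold ofZ toZ; cases v b <;> decide

/-- `toZ ∘ ofZ = id`. -/
theorem toZ_ofZ (y : Fin m → ZMod 2) : toZ (ofZ y) = y := by
  funext b
  have key : ∀ a : ZMod 2, (if decide (a = 1) = true then (1 : ZMod 2) else 0) = a := by decide
  exact key (y b)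

/-- `ofZ 0` is the zero vector. -/
theorem ofZ_zero : ofZ (0 : Fin m → ZMod 2) = fun _ => false := by
  funext b; simp [ofZ]

/-- `ofZ` turns `+` into `⊕`. -/
theorem ofZ_add (y y' : Fin m → ZMod 2) : ofZ (y + y') = fun b => xor (ofZ y b) (ofZ y' b) := by
  funext b; unfold ofZ; rw [Pi.add_apply]
  generalize y b = a; generalize y' b = a'
  fin_cases a <;> fin_cases a' <;> decide

/-- **N3 for graphs ("few kernel types ⇒ easy")**: for a symmetric loop-free `adj`, if every kernel
`Ker(A_G + diag x)` is spanned by the members of ONE fixed independent list `L` lying in it, then the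
degree-`2` map `s(x) = Σ_j ℓ_x(L_j)·w_j` (`w` dual to `L`) solves every instance of `RelG`. -/
theorem fewTypesEasy_graph (k : ℕ) (hs : ∀ a b, adj a b = adj b a) (hl : ∀ a, adj a a = false)
    (L : Fin k → (Fin m → Bool)) (hli : LinearIndependent (ZMod 2) (fun j => toZ (L j)))
    (hspan : ∀ x v : Fin m → Bool, InKernelG adj x v →
      toZ v ∈ Submodule.span (ZMod 2) (toZ '' {w | (∃ j, w = L j) ∧ InKernelG adj x w})) :
    ∃ s : Fin m → CubeFn (ZMod 2) m, (∀ i, s i ∈ lowDeg (ZMod 2) m 2) ∧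
      ∀ x : Fin m → Bool, RelG adj x (fun i => decide (s i x = 1)) := by
  classical
  obtain ⟨w, hw⟩ := exists_dualVec L hli
  refine ⟨fun i x => ∑ j : Fin k, ellF adj (L j) x * w j i, fun i => ?_, fun x => ?_⟩
  · have heq : (fun x => ∑ j : Fin k, ellF adj (L j) x * w j i) = ∑ j : Fin k, (w j i) • ellF adj (L j) := by
      funext x
      simp only [Finset.sum_apply, Pi.smul_apply, smul_eq_mul]
      exact Finset.sum_congr rfl fun j _ => mul_comm _ _
    show (fun x => ∑ j : Fin k, ellF adj (L j) x * w j i) ∈ lowDeg (ZMod 2) m 2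
    rw [heq]
    exact Submodule.sum_mem _ fun j _ => Submodule.smul_mem _ _ (ellF_mem_lowDeg_two (L j))
  · intro v hv
    -- the output at `x`
    set S : Fin m → ZMod 2 := fun b => ∑ j : Fin k, ellF adj (L j) x * w j b with hS
    -- along the span: kernel membership and `⟨y, S⟩ = ℓ_x(y)`
    have key : ∀ y ∈ Submodule.span (ZMod 2) (toZ '' {w | (∃ j, w = L j) ∧ InKernelG adj x w}),
        InKernelG adj x (ofZ y) ∧ ∑ b : Fin m, y b * S b = ellF adj (ofZ y) x := by
      intro y hy
      induction hy using Submodule.span_induction with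
      | mem y hy =>
        obtain ⟨w', ⟨⟨j, rfl⟩, hker⟩, rfl⟩ := hy
        rw [ofZ_toZ]
        refine ⟨hker, ?_⟩
        simp only [hS]
        have hre : (∑ b : Fin m, toZ (L j) b * ∑ j' : Fin k, ellF adj (L j') x * w j' b) =
            ∑ j' : Fin k, ellF adj (L j') x * ∑ b : Fin m, toZ (L j) b * w j' b := by
          calc (∑ b : Fin m, toZ (L j) b * ∑ j' : Fin k, ellF adj (L j') x * w j' b)
              = ∑ b : Fin m, ∑ j' : Fin k, ellF adj (L j') x * (toZ (L j) b * w j' b) := by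
                refine Finset.sum_congr rfl fun b _ => ?_
                rw [Finset.mul_sum]
                refine Finset.sum_congr rfl fun j' _ => ?_
                ring
            _ = ∑ j' : Fin k, ∑ b : Fin m, ellF adj (L j') x * (toZ (L j) b * w j' b) := Finset.sum_comm
            _ = ∑ j' : Fin k, ellF adj (L j') x * ∑ b : Fin m, toZ (L j) b * w j' b := by
                refine Finset.sum_congr rfl fun j' _ => ?_
                rw [Finset.mul_sum]
        rw [hre]
        simp only [hw j, mul_ite, mul_one, mul_zero]
        rw [Finset.sum_ite_eq]
        simp
      | zero =>
        rw [ofZ_zero]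
        refine ⟨inKernelG_zero x, ?_⟩
        simp [ellF, signBitG_zero]
      | add y y' _ _ hy hy' =>
        obtain ⟨hk1, hs1⟩ := hy
        obtain ⟨hk2, hs2⟩ := hy'
        rw [ofZ_add]
        refine ⟨inKernelG_xor x hk1 hk2, ?_⟩
        have hxor := signBitG_xor x hs hl hk1 hk2
        simp only [ellF] at hs1 hs2 ⊢
        rw [hxor, ZMod.natCast_mod, Nat.cast_add, ← hs1, ← hs2, ← Finset.sum_add_distrib]
        refine Finset.sum_congr rfl fun b _ => ?_
        rw [Pi.add_apply]; ring
      | smul a y _ hy =>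
        have ha : a = 0 ∨ a = 1 := by revert a; decide
        rcases ha with rfl | rfl
        · rw [zero_smul, ofZ_zero]
          refine ⟨inKernelG_zero x, ?_⟩
          simp [ellF, signBitG_zero]
        · rw [one_smul]
          exact hy
    obtain ⟨_, hsum⟩ := key (toZ v) (hspan x v hv)
    rw [ofZ_toZ] at hsum
    -- `dot2 v z` and `ℓ_x(v)` agree in `𝔽₂`, hence as residues
    have hdot : (((univ.filter fun b : Fin m => v b = true ∧ decide (S b = 1) = true).card : ℕ) : ZMod 2) =
        ∑ b : Fin m, toZ v b * S b := by
      rw [Finset.card_filter]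
      push_cast
      refine Finset.sum_congr rfl fun b _ => ?_
      unfold toZ
      generalize S b = a
      cases v b <;> fin_cases a <;> decide
    unfold dot2
    have hcast : (((univ.filter fun b : Fin m => v b = true ∧ decide (S b = 1) = true).card : ℕ) : ZMod 2) =
        ((signBitG adj x v : ℕ) : ZMod 2) := by
      rw [hdot, hsum]; rfl
    rw [ZMod.natCast_eq_natCast_iff'] at hcast
    have hlt : signBitG adj x v < 2 := by unfold signBitG; exact Nat.mod_lt _ (by norm_num)
    rw [Nat.mod_eq_of_lt hlt] at hcast
    exact hcast

end GraphN3

open GraphN3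

/-- The repaired `FewTypesEasy` (adjacency symmetric with zero diagonal), in the planner's shape. -/
theorem fewTypesEasy_of_graph :
    ∀ (m k : ℕ) (adj : Fin m → Fin m → Bool), (∀ a b, adj a b = adj b a) → (∀ a, adj a a = false) →
      ∀ (L : Fin k → (Fin m → Bool)),
      LinearIndependent (ZMod 2) (fun j => toZ (L j)) →
      (∀ x v : Fin m → Bool, InKernelG adj x v →
        toZ v ∈ Submodule.span (ZMod 2) (toZ '' {w | (∃ j, w = L j) ∧ InKernelG adj x w})) →
      ∃ s : Fin m → CubeFn (ZMod 2) m, (∀ i, s i ∈ lowDeg (ZMod 2) m 2) ∧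
        ∀ x : Fin m → Bool, RelG adj x (fun i => decide (s i x = 1)) :=
  fun _ k _ hs hl L hli hspan => fewTypesEasy_graph k hs hl L hli hspan

end Summit.QuantumAdvantage.AdviceFreeQNC0
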